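import Literature.AnabelianGeometry.SemiGraphs.SpecialFibreConjugationGraphic
import Literature.AnabelianGeometry.SemiGraphs.TemperedDecompositionTransport
import Literature.AnabelianGeometry.SemiGraphs.TemperedReconstructionR3SubCompatAt
import Literature.AnabelianGeometry.SemiGraphs.TemperedReconstructionCor39UpToTwist
import Literature.AnabelianGeometry.SemiGraphs.TemperedSpecialFibreGraphEquivalence
import Literature.AnabelianGeometry.SemiGraphs.TemperedSpecialFibreCor311EquivarianceAut
import HarnessLib

/-!
# The conjugation action on the special fibre INDUCES `autOfConj g` up to twist, and the group-level
# `hHstab` of [IUTchI] Cor. 2.3 (i) DERIVED from [SemiAnbd] Cor. 3.9 at finite special fibres (proof-only)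

Mochizuki, *Semi-graphs of anabelioids*, Publ. RIMS **42** (2006), §3: Prop. 3.6 (iv) p. 39 (a morphism of
semi-graphs of anabelioids induces, via `B^temp`, an outer homomorphism of tempered fundamental groups), Cor. 3.9
pp. 42–43 (graphicity), Ex. 3.10 p. 44, Cor. 3.11 proof p. 46 ("by Corollary 3.9, we conclude that `γ` induces a
natural, functorial isomorphism of graphs of anabelioids `𝒢[α]_Σ ⥲ 𝒢[β]_Σ`") [cite: MochizukiSemiAnbd2006, Cor 3.9 pp.42-43];
Mochizuki, *Inter-universal Teichmüller theory I*, §2 p. 44 l. 39–44 (decomposition groups `Π^tp_ℍ ⊆ Π^tp_𝔾`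
"well-defined up to conjugation"), p. 47 l. 22–24 ("`ℍ ⊆ 𝔾` is stabilized by the natural action of `G_k` on `𝔾`"),
Cor. 2.3 (i) p. 47 [cite: Mochizuki2012, IUTchI Cor 2.3(i) p.47] [claim: Mochizuki2012, status: disputed]
(nothing of the IUT series is asserted here).

abc-iut cell, layer L3, seat abc-iut-L3-d1 gen 12, row «AUTOFCONJ-INDUCES-UPTOTWIST + HHSTAB-DERIVED@FINITE-
SPECIAL-FIBRE» (the banked sequel (ii) of gen 11's `SpecialFibreConjugationGraphic.lean`, carried to its consumer).
PROOF-ONLY (no definition, no instance, no notation, no `Prop` fact); inputs BY NAME: abc-iut-w4-d052's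
decomposition-subgroup transport (`TemperedDecompositionTransport.lean`: `map_mem_decompSubgroups_of_compat`,
`exists_conj_of_mem_decompSubgroups`), abc-iut-L3-d6's `Hom.btempPullbackEquiv` / abc-iut-w4-d052's
`Hom.btempRestrictPullbackIso` (both already parametrised by a conjugator family `θ`), the (R3) step of Cor. 3.9
AT `ℋ` (`chartPullbackWith_iso_of_compatibleAt`, Thm. 3.7 (iii) at finite graphs `compactInVerticialAt_of_finiteGraph`),
abc-iut-w4-d083's Cor. 3.9 in isomorphism form at finite special fibres and `SpecialFibreData.GraphCompatible`,
abc-iut-L3-t2's `autOfConj` / `actVertex` dictionary, gen 11's A1/A3.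

WHAT IS PROVED.
* §1 `TemperedPiChart.map_mem_decompSubgroups_of_inducesWith`, `exists_conj_map_eq_of_inducesWith` — the (P4-i)
  transport of decomposition subgroups `Π^tp_ℍ` along an isomorphism `F` of semi-graphs of anabelioids for a
  homomorphism `φ` induced by `F` glued with an ARBITRARY family `θ` of conjugating elements (`Hom.InducesWith θ`;
  so `Hom.InducesUpToTwist` suffices): the frozen `Hom.Induces` (= the CHOSEN family) is the special case.  The
  group-level statement "`φ(D)` is a decomposition subgroup of `F(ℍ)` / a conjugate of `D`" is insensitive to the
  2-cells of Rmk. 2.4.2.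
* §2 `SpecialFibreData.inducesUpToTwist_of_graphCompatible` — at FINITE special fibres, a locally open
  `F₀ : 𝒢[α] → 𝒢[β]` compatible with an isomorphism `φ` of the tempered fundamental groups on verticial and edge
  homomorphisms INDUCES `φ` UP TO TWIST through the charts of `𝒢^c[□]` transported along the cusp-omission
  equivalences `B^temp(𝒢^c) ≌ B^temp(𝒢)` (print's Prop. 3.6 (iv) currency "`γ` induces a natural isomorphism of
  graphs of anabelioids", functor level: `B^temp(φ) ≅ c_β⁻¹ ⋙ F₀^*_θ ⋙ c_α`); with `exists_isIso_inducesUpToTwist_of_finite`.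
* §3 `SpecialFibreData.exists_conj_map_eq_of_graphCompatible` — for an ISOMORPHISM `F₀ : 𝒢 ⥲ 𝒢` of the
  cusp-omitted base fibre compatible with `φ : π₁^temp(𝒢^c) ⥲ π₁^temp(𝒢^c)` and a sub-semi-graph `ℍ₀ ⊆ 𝒢` with
  `F₀⁻¹(ℍ₀) = ℍ₀`, every decomposition subgroup `D` of `ℍ₀` (for the transported chart — SAME group `π₁^temp(𝒢^c)`)
  satisfies `φ(D) = t D t⁻¹` for some `t`.
* §4 at `φ := autOfConj g` (`g ∈ Π`): `exists_isIso_inducesUpToTwist_autOfConj` (the Cor-3.9 isomorphism of gen 11's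
  A1 induces `autOfConj g` up to twist, vertex map `actVertex g`), and ★ `exists_conj_map_autOfConj_of_mem_decompSubgroups`:
  for every `ℍ₀ ⊆ 𝒢` whose vertices are stable under the derived vertex action `actVertex g` and whose edges are stable
  under the (UNIQUE, Cor. 3.9 (b)) base of the compatible isomorphisms, and every decomposition subgroup `D` of `ℍ₀`:
  `∃ t, D.map (autOfConj g) = MulAut.conj t • D` — the GROUP-LEVEL `hHstab` of [IUTchI] Cor. 2.3 (i) ("the natural
  outer actions of `G_k` on `Δ^tp_X` determine natural outer actions on `Δ^tp_{X,ℍ}`") DERIVED at finite special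
  fibres, WITHOUT the origin datum `PiData.ActGraphInduces` (p484597).
* §5 at the origin record `P : SpecialFibreTower.PiData` (finite base fibre): vertex-stability of `ℍ₀ := ℍ ∩ 𝒢` is
  AUTOMATIC from the record's `H_stable` (gen 11's C2: the derived vertex map IS `actGraph₀ g` on vertices); what
  stays DISPLAYED is the stability of the edges of `ℍ₀` under the DERIVED edge maps (honest: the record's `actGraph₀`
  edge part is unconstrained by any law of `PiData` — abc-iut-L3-lead γ32 (2) witness: two vertices joined by two
  nodes `e₁, e₂`, `ℍ ∋ e₁ ∌ e₂`).

HONEST RESIDUAL / NOT HERE.  (a) The decomposition subgroups are those of `ℍ₀ ⊆ 𝒢` (cusp-omitted base fibre) for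
the transported chart; the JUNCTION with abc-iut-L5's currency `S.chart.decompSubgroups ℍ` for `ℍ ⊆ 𝔾^c` WITH cusps
(cusp-omission invariance of decomposition subgroups, a restrict–restrict comparison) is the sequel.  (b) The edge
stability of `ℍ₀` under the derived isomorphisms is a hypothesis (see §5).  Nothing here is a claim about print
beyond OUR finite carriers; no side is taken on [IUTchIII] Cor. 3.12; nothing here asserts that abc is proved or
refuted; typed ≠ proved.
-/

noncomputable section

namespace Literature.AnabelianGeometry.SemiGraphs

open CategoryTheory ProfiniteSemiGraph
open scoped Pointwise

universe u

/-! ### §1. Transport of decomposition subgroups for an ARBITRARY conjugator family (`InducesWith θ`) -/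

namespace ProfiniteSemiGraph

namespace TemperedPiChart

/-- **Decomposition subgroups transport along an isomorphism of semi-graphs of anabelioids, `∃ θ` reading**
([SemiAnbd] Prop. 3.6 (iv) with the 2-cells of Rmk. 2.4.2; [IUTchI] §2 p. 44): for `F : 𝒢 → ℋ` locally trivial
and an isomorphism on underlying semi-graphs, ANY family `θ` of conjugating elements, charts `c𝒢`, `cℋ`, a
homomorphism `φ` with `F.InducesWith θ c𝒢 cℋ φ` (`B^temp(φ) ≅ cℋ⁻¹ ⋙ F^*_θ ⋙ c𝒢`), and sub-semi-graphs with
`ℍ = F⁻¹(ℍ′)`: the image `φ(D)` of every `D ∈ decompSubgroups c𝒢 ℍ` is a decomposition subgroup of `ℍ′`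
(abc-iut-w4-d052's `map_mem_decompSubgroups_of_compat` with `P := F^*_θ`, `E := (F|_ℍ)^*_{θ|ℍ}`, compatibility
`btempRestrictPullbackIso … θ`). [cite: MochizukiSemiAnbd2006, Prop 3.6(iv) p.39] -/
theorem map_mem_decompSubgroups_of_inducesWith {𝒢 ℋ : ProfiniteSemiGraph.{u}} (F : Hom 𝒢 ℋ)
    (hlt : F.IsLocallyTrivial) [CategoryTheory.IsIso (C := SemiGraph.{u}) F.base] (θ : F.ConjugatorFamily)
    (c𝒢 : TemperedPiChart 𝒢) (cℋ : TemperedPiChart ℋ) {φ : c𝒢.G →ₜ* cℋ.G} (hφ : F.InducesWith θ c𝒢 cℋ φ)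
    {H : 𝒢.graph.Subgraph} {H' : ℋ.graph.Subgraph} (hV : ∀ v, v ∈ H.verts ↔ F.base.vertexMap v ∈ H'.verts)
    (hE : ∀ e, e ∈ H.edges ↔ F.base.edgeMap e ∈ H'.edges) {D : Subgroup c𝒢.G}
    (hD : D ∈ c𝒢.decompSubgroups H) : D.map φ.toMonoidHom ∈ cℋ.decompSubgroups H' := by
  have hV₁ : H.verts ⊆ F.base.vertexMap ⁻¹' H'.verts := fun v hv => (hV v).mp hv
  have hE₁ : H.edges ⊆ F.base.edgeMap ⁻¹' H'.edges := fun e he => (hE e).mp he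
  haveI := F.isIso_restrictSub_base H H' hV₁ hE₁ (fun v hv => (hV v).mpr hv) (fun e he => (hE e).mpr he)
  exact map_mem_decompSubgroups_of_compat (F.btempPullbackWith θ) hφ
    ((F.restrictSub H H' hV₁ hE₁).btempPullbackEquiv (hlt.restrictSub H H' hV₁ hE₁)
      (θ.restrictSub H H' hV₁ hE₁))
    ⟨(F.btempRestrictPullbackIso H H' hV₁ hE₁ θ).symm⟩ hD

/-- The same under `F.InducesUpToTwist` (SOME family `θ`). [cite: MochizukiSemiAnbd2006, Prop 3.6(iv) p.39] -/
theorem map_mem_decompSubgroups_of_inducesUpToTwist {𝒢 ℋ : ProfiniteSemiGraph.{u}} (F : Hom 𝒢 ℋ)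
    (hlt : F.IsLocallyTrivial) [CategoryTheory.IsIso (C := SemiGraph.{u}) F.base]
    (c𝒢 : TemperedPiChart 𝒢) (cℋ : TemperedPiChart ℋ) {φ : c𝒢.G →ₜ* cℋ.G} (hφ : F.InducesUpToTwist c𝒢 cℋ φ)
    {H : 𝒢.graph.Subgraph} {H' : ℋ.graph.Subgraph} (hV : ∀ v, v ∈ H.verts ↔ F.base.vertexMap v ∈ H'.verts)
    (hE : ∀ e, e ∈ H.edges ↔ F.base.edgeMap e ∈ H'.edges) {D : Subgroup c𝒢.G}
    (hD : D ∈ c𝒢.decompSubgroups H) : D.map φ.toMonoidHom ∈ cℋ.decompSubgroups H' := by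
  obtain ⟨θ, hθ⟩ := hφ
  exact map_mem_decompSubgroups_of_inducesWith F hlt θ c𝒢 cℋ hθ hV hE hD

/-- **The group-level `hHstab` from an `ℍ`-stabilising automorphism, `∃ θ` reading**: for `F : 𝒢 → 𝒢` locally
trivial, iso on the underlying semi-graph, with `F⁻¹(ℍ) = ℍ`, inducing `φ` UP TO TWIST on a chart `c`, and any
`D ∈ decompSubgroups c ℍ`: `φ(D)` is a `π₁^temp(𝒢)`-conjugate of `D` (one conjugacy class,
`exists_conj_of_mem_decompSubgroups`). [cite: Mochizuki2012, IUTchI Cor 2.3(i) p.47] -/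
theorem exists_conj_map_eq_of_inducesUpToTwist {𝒢 : ProfiniteSemiGraph.{u}} (F : Hom 𝒢 𝒢)
    (hlt : F.IsLocallyTrivial) [CategoryTheory.IsIso (C := SemiGraph.{u}) F.base] (c : TemperedPiChart 𝒢)
    {φ : c.G →ₜ* c.G} (hφ : F.InducesUpToTwist c c φ) {H : 𝒢.graph.Subgraph}
    (hV : ∀ v, v ∈ H.verts ↔ F.base.vertexMap v ∈ H.verts) (hE : ∀ e, e ∈ H.edges ↔ F.base.edgeMap e ∈ H.edges)
    {D : Subgroup c.G} (hD : D ∈ c.decompSubgroups H) :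
    ∃ g : c.G, D.map φ.toMonoidHom = D.map (MulAut.conj g).toMonoidHom :=
  exists_conj_of_mem_decompSubgroups hD (map_mem_decompSubgroups_of_inducesUpToTwist F hlt c c hφ hV hE hD)

end TemperedPiChart

end ProfiniteSemiGraph

/-! ### §2. At finite special fibres: compatible `F₀ : 𝒢[α] → 𝒢[β]` INDUCES `φ` up to twist -/

section Pair

variable {Kα : Type u} [Field Kα] {Kβ : Type u} [Field Kβ]
  {Dα : TemperedArithmeticGroup Kα} {Dβ : TemperedArithmeticGroup Kβ}
  (Sα : SpecialFibreData Dα) (Sβ : SpecialFibreData Dβ)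

/-- **A compatible locally open `F₀ : 𝒢[α] → 𝒢[β]` INDUCES `φ` UP TO TWIST** (print p. 46 "`γ` induces a natural,
functorial isomorphism of graphs of anabelioids"; Prop. 3.6 (iv) currency): at finite special fibres, for the
charts of `𝒢^c[□]` transported along the cusp-omission equivalences `B^temp(𝒢^c[□]) ≌ B^temp(𝒢[□])` (same groups
`π₁^temp(𝒢^c[□])`), `B^temp(φ) ≅ c_β⁻¹ ⋙ F₀^*_θ ⋙ c_α` for SOME family `θ` of conjugating elements — the (R3) step of
Cor. 3.9 AT the finite graph `𝒢[β]` (Thm. 3.7 (iii) there is a theorem of the tree).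
[cite: MochizukiSemiAnbd2006, Cor 3.11 p.46] -/
theorem SpecialFibreData.inducesUpToTwist_of_graphCompatible [Finite Sα.Gc.graph.Vertex]
    [Finite Sα.Gc.graph.Edge] [Finite Sβ.Gc.graph.Vertex] [Finite Sβ.Gc.graph.Edge]
    (φ : Sα.chart.G ≃ₜ* Sβ.chart.G) {F₀ : Hom Sα.graph Sβ.graph} (hF₀ : F₀.IsLocallyOpen)
    (h : Sα.GraphCompatible Sβ φ F₀) :
    F₀.InducesUpToTwist
      (Sα.chart.transport (haveI := Sα.isEquivalence_btempRestrict_graphOf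
        (Sα.Gc.btempRestrict Sα.Gc.graph.maximalSubgraph).asEquivalence.symm))
      (Sβ.chart.transport (haveI := Sβ.isEquivalence_btempRestrict_graphOf
        (Sβ.Gc.btempRestrict Sβ.Gc.graph.maximalSubgraph).asEquivalence.symm))
      (φ : Sα.chart.G →ₜ* Sβ.chart.G) := by
  haveI := Sα.finite_graph_vertex; haveI := Sα.finite_graph_edge
  haveI := Sβ.finite_graph_vertex; haveI := Sβ.finite_graph_edge
  haveI := Sα.isEquivalence_btempRestrict_graphOf
  haveI := Sβ.isEquivalence_btempRestrict_graphOf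
  let cα : TemperedPiChart Sα.graph :=
    Sα.chart.transport (Sα.Gc.btempRestrict Sα.Gc.graph.maximalSubgraph).asEquivalence.symm
  let cβ : TemperedPiChart Sβ.graph :=
    Sβ.chart.transport (Sβ.Gc.btempRestrict Sβ.Gc.graph.maximalSubgraph).asEquivalence.symm
  have hV : F₀.CompatV cα cβ (φ : Sα.chart.G →ₜ* Sβ.chart.G) := fun v ψ ψ' hψ hψ' => h.1 v ψ ψ' hψ hψ'
  have hE : F₀.CompatE cα cβ (φ : Sα.chart.G →ₜ* Sβ.chart.G) := fun e ψ ψ' hψ hψ' => h.2 e ψ ψ' hψ hψ'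
  exact chartPullbackWith_iso_of_compatibleAt compactInVerticialAt_of_finiteGraph Sα.cor39Hypotheses_graph
    Sβ.cor39Hypotheses_graph cα cβ F₀ _ hF₀ hV hE

/-- **Cor. 3.9 at a finite pair, functor-level form**: an isomorphism `φ : π₁^temp(𝒢^c[α]) ⥲ π₁^temp(𝒢^c[β])` is
induced UP TO TWIST by an ISOMORPHISM `F₀ : 𝒢[α] ⥲ 𝒢[β]` of the cusp-omitted graphs of anabelioids which is compatible
with `φ` on verticial and edge homomorphisms (abc-iut-w4-d083's `exists_isIso_graphCompatible_of_finite` + §2).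
[cite: MochizukiSemiAnbd2006, Cor 3.11 p.46] -/
theorem SpecialFibreData.exists_isIso_inducesUpToTwist_of_finite [Finite Sα.Gc.graph.Vertex]
    [Finite Sα.Gc.graph.Edge] [Finite Sβ.Gc.graph.Vertex] [Finite Sβ.Gc.graph.Edge]
    (φ : Sα.chart.G ≃ₜ* Sβ.chart.G) :
    ∃ F₀ : Hom Sα.graph Sβ.graph, F₀.IsIso ∧ Sα.GraphCompatible Sβ φ F₀ ∧
      F₀.InducesUpToTwist
        (Sα.chart.transport (haveI := Sα.isEquivalence_btempRestrict_graphOf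
          (Sα.Gc.btempRestrict Sα.Gc.graph.maximalSubgraph).asEquivalence.symm))
        (Sβ.chart.transport (haveI := Sβ.isEquivalence_btempRestrict_graphOf
          (Sβ.Gc.btempRestrict Sβ.Gc.graph.maximalSubgraph).asEquivalence.symm))
        (φ : Sα.chart.G →ₜ* Sβ.chart.G) := by
  obtain ⟨F₀, hF₀, hc⟩ := Sα.exists_isIso_graphCompatible_of_finite Sβ φ
  exact ⟨F₀, hF₀, hc, Sα.inducesUpToTwist_of_graphCompatible Sβ φ hF₀.isLocallyTrivial.isLocallyOpen hc⟩

end Pair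

/-! ### §3. `hHstab` at the cusp-omitted fibre from a compatible ℍ₀-stabilising isomorphism -/

namespace SpecialFibreData

variable {K : Type u} [Field K] {D : TemperedArithmeticGroup K} (S : SpecialFibreData D)

/-- **Decomposition subgroups of a sub-semi-graph `ℍ₀ ⊆ 𝒢` of the cusp-omitted fibre are carried to decomposition
subgroups of `F₀(ℍ₀)`** by every isomorphism `φ` of `π₁^temp(𝒢^c)` compatible with an isomorphism `F₀ : 𝒢 ⥲ 𝒢`
(finite fibre; transported chart, same group). [cite: Mochizuki2012, IUTchI §2 p.44] -/
theorem map_mem_decompSubgroups_of_graphCompatible [Finite S.Gc.graph.Vertex] [Finite S.Gc.graph.Edge]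
    (φ : S.chart.G ≃ₜ* S.chart.G) {F₀ : Hom S.graph S.graph} (hF₀ : F₀.IsIso) (h : S.GraphCompatible S φ F₀)
    {H₀ H₀' : S.graph.graph.Subgraph} (hV : ∀ v, v ∈ H₀.verts ↔ F₀.base.vertexMap v ∈ H₀'.verts)
    (hE : ∀ e, e ∈ H₀.edges ↔ F₀.base.edgeMap e ∈ H₀'.edges) {Dg : Subgroup S.chart.G}
    (hD : Dg ∈ (S.chart.transport (haveI := S.isEquivalence_btempRestrict_graphOf
        (S.Gc.btempRestrict S.Gc.graph.maximalSubgraph).asEquivalence.symm)).decompSubgroups H₀) :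
    Dg.map (φ : S.chart.G →ₜ* S.chart.G).toMonoidHom ∈
      (S.chart.transport (haveI := S.isEquivalence_btempRestrict_graphOf
        (S.Gc.btempRestrict S.Gc.graph.maximalSubgraph).asEquivalence.symm)).decompSubgroups H₀' := by
  haveI := hF₀.isIso_base
  exact TemperedPiChart.map_mem_decompSubgroups_of_inducesUpToTwist F₀ hF₀.isLocallyTrivial _ _
    (S.inducesUpToTwist_of_graphCompatible S φ hF₀.isLocallyTrivial.isLocallyOpen h) hV hE hD

/-- **`hHstab` at the cusp-omitted fibre**: for an isomorphism `F₀ : 𝒢 ⥲ 𝒢` compatible with `φ` and a sub-semi-graph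
`ℍ₀ ⊆ 𝒢` with `F₀⁻¹(ℍ₀) = ℍ₀` (vertices AND edges), every decomposition subgroup `D` of `ℍ₀` has `φ(D) = t D t⁻¹`
for some `t ∈ π₁^temp(𝒢^c)`. [cite: Mochizuki2012, IUTchI Cor 2.3(i) p.47] -/
theorem exists_conj_map_eq_of_graphCompatible [Finite S.Gc.graph.Vertex] [Finite S.Gc.graph.Edge]
    (φ : S.chart.G ≃ₜ* S.chart.G) {F₀ : Hom S.graph S.graph} (hF₀ : F₀.IsIso) (h : S.GraphCompatible S φ F₀)
    {H₀ : S.graph.graph.Subgraph} (hV : ∀ v, v ∈ H₀.verts ↔ F₀.base.vertexMap v ∈ H₀.verts)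
    (hE : ∀ e, e ∈ H₀.edges ↔ F₀.base.edgeMap e ∈ H₀.edges) {Dg : Subgroup S.chart.G}
    (hD : Dg ∈ (S.chart.transport (haveI := S.isEquivalence_btempRestrict_graphOf
        (S.Gc.btempRestrict S.Gc.graph.maximalSubgraph).asEquivalence.symm)).decompSubgroups H₀) :
    ∃ t : S.chart.G, Dg.map (φ : S.chart.G →ₜ* S.chart.G).toMonoidHom = Dg.map (MulAut.conj t).toMonoidHom := by
  haveI := hF₀.isIso_base
  exact TemperedPiChart.exists_conj_map_eq_of_inducesUpToTwist F₀ hF₀.isLocallyTrivial _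
    (S.inducesUpToTwist_of_graphCompatible S φ hF₀.isLocallyTrivial.isLocallyOpen h) hV hE hD

/-! ### §4. At `φ := autOfConj g`: the conjugation action induces `autOfConj g` up to twist; `hHstab` derived -/

/-- **`autOfConj g` is INDUCED UP TO TWIST by the Cor-3.9 isomorphism of the cusp-omitted special fibre** (gen 11's
A1 `exists_isIso_graphCompatible_autOfConj` + §2), whose vertex map is the derived vertex action `actVertex g` (A3):
at finite `𝒢^c`, for every `g ∈ Π`. [cite: MochizukiSemiAnbd2006, Cor 3.9 p.42] -/
theorem exists_isIso_inducesUpToTwist_autOfConj [Finite S.Gc.graph.Vertex] [Finite S.Gc.graph.Edge]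
    (hK0 : (S.admissible.toMonoidHom.ker.map D.delta.subtype).Normal) (g : D.Pi) :
    ∃ F₀ : Hom S.graph S.graph, F₀.IsIso ∧ S.GraphCompatible S (S.autOfConj hK0 g) F₀ ∧
      F₀.InducesUpToTwist
        (S.chart.transport (haveI := S.isEquivalence_btempRestrict_graphOf
          (S.Gc.btempRestrict S.Gc.graph.maximalSubgraph).asEquivalence.symm))
        (S.chart.transport (haveI := S.isEquivalence_btempRestrict_graphOf
          (S.Gc.btempRestrict S.Gc.graph.maximalSubgraph).asEquivalence.symm))
        (S.autOfConj hK0 g : S.chart.G →ₜ* S.chart.G) ∧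
      ∀ v : S.graph.graph.Vertex,
        (F₀.base.vertexMap v).1 = S.actVertex hK0 maximalCompactIffVerticialAt_of_finiteGraph g v.1 := by
  obtain ⟨F₀, hF₀, hc, hind⟩ := S.exists_isIso_inducesUpToTwist_of_finite S (S.autOfConj hK0 g)
  exact ⟨F₀, hF₀, hc, hind, fun v => S.graphCompatible_autOfConj_vertexMap hK0 _ g hF₀ hc v⟩

/-- **`hHstab` DERIVED, given the compatible isomorphism**: for `F₀ : 𝒢 ⥲ 𝒢` compatible with `autOfConj g` (A1)
and `ℍ₀ ⊆ 𝒢` with `F₀⁻¹(ℍ₀) = ℍ₀`, every decomposition subgroup `D` of `ℍ₀` satisfies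
`D.map (autOfConj g) = MulAut.conj t • D` for some `t` — the shape of abc-iut-L5's `hHstab`.
[cite: Mochizuki2012, IUTchI Cor 2.3(i) p.47] -/
theorem exists_conj_map_autOfConj_of_graphCompatible [Finite S.Gc.graph.Vertex] [Finite S.Gc.graph.Edge]
    (hK0 : (S.admissible.toMonoidHom.ker.map D.delta.subtype).Normal) (g : D.Pi)
    {F₀ : Hom S.graph S.graph} (hF₀ : F₀.IsIso) (h : S.GraphCompatible S (S.autOfConj hK0 g) F₀)
    {H₀ : S.graph.graph.Subgraph} (hV : ∀ v, v ∈ H₀.verts ↔ F₀.base.vertexMap v ∈ H₀.verts)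
    (hE : ∀ e, e ∈ H₀.edges ↔ F₀.base.edgeMap e ∈ H₀.edges) {Dg : Subgroup S.chart.G}
    (hD : Dg ∈ (S.chart.transport (haveI := S.isEquivalence_btempRestrict_graphOf
        (S.Gc.btempRestrict S.Gc.graph.maximalSubgraph).asEquivalence.symm)).decompSubgroups H₀) :
    ∃ t : S.chart.G, Dg.map (S.autOfConj hK0 g).toMulEquiv.toMonoidHom = MulAut.conj t • Dg := by
  obtain ⟨t, ht⟩ := S.exists_conj_map_eq_of_graphCompatible (S.autOfConj hK0 g) hF₀ h hV hE hD
  exact ⟨t, ht⟩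

/-- ★ **`hHstab` of [IUTchI] Cor. 2.3 (i) DERIVED from Cor. 3.9 at finite special fibres, WITHOUT the origin datum
`PiData.ActGraphInduces`**: for every `g ∈ Π` and every sub-semi-graph `ℍ₀ ⊆ 𝒢` of the cusp-omitted fibre whose
VERTICES are stable under the derived vertex action `actVertex g` and whose EDGES are stable under the base of the
(every) isomorphism `𝒢 ⥲ 𝒢` compatible with `autOfConj g` (that base is UNIQUE, Cor. 3.9 (b); A2), every
decomposition subgroup `D` of `ℍ₀` satisfies `D.map (autOfConj g) = MulAut.conj t • D` for some `t ∈ π₁^temp(𝒢^c)`.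
[cite: Mochizuki2012, IUTchI Cor 2.3(i) p.47] -/
theorem exists_conj_map_autOfConj_of_mem_decompSubgroups [Finite S.Gc.graph.Vertex] [Finite S.Gc.graph.Edge]
    (hK0 : (S.admissible.toMonoidHom.ker.map D.delta.subtype).Normal) (g : D.Pi)
    {H₀ : S.graph.graph.Subgraph}
    (hHV : ∀ v : S.graph.graph.Vertex, v ∈ H₀.verts ↔
      S.maximalSubgraph_isCuspOmission.vtx
        (S.actVertex hK0 maximalCompactIffVerticialAt_of_finiteGraph g v.1) ∈ H₀.verts)
    (hHE : ∀ F₀ : Hom S.graph S.graph, F₀.IsIso → S.GraphCompatible S (S.autOfConj hK0 g) F₀ →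
      ∀ e, e ∈ H₀.edges ↔ F₀.base.edgeMap e ∈ H₀.edges)
    {Dg : Subgroup S.chart.G}
    (hD : Dg ∈ (S.chart.transport (haveI := S.isEquivalence_btempRestrict_graphOf
        (S.Gc.btempRestrict S.Gc.graph.maximalSubgraph).asEquivalence.symm)).decompSubgroups H₀) :
    ∃ t : S.chart.G, Dg.map (S.autOfConj hK0 g).toMulEquiv.toMonoidHom = MulAut.conj t • Dg := by
  obtain ⟨F₀, hF₀, hc, -, hv⟩ := S.exists_isIso_inducesUpToTwist_autOfConj hK0 g
  refine S.exists_conj_map_autOfConj_of_graphCompatible hK0 g hF₀ hc (fun v => ?_) (hHE F₀ hF₀ hc) hD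
  have hFv : F₀.base.vertexMap v =
      S.maximalSubgraph_isCuspOmission.vtx
        (S.actVertex hK0 maximalCompactIffVerticialAt_of_finiteGraph g v.1) :=
    Subtype.ext (hv v)
  rw [hFv]
  exact hHV v

end SpecialFibreData

/-! ### §5. At the origin record `PiData`: vertex-stability automatic, edge-stability of the derived maps displayed -/

namespace SpecialFibreTower

namespace PiData

open SpecialFibreData

variable {p : ℕ} [Fact p.Prime] {X : TemperedCurve p} {d : X.GroupLevelData}
  {S : SpecialFibreData (X.toTemperedArithmeticGroup d)} {T : SpecialFibreTower X.DeltaTemp}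

/-- The record's `ℍ` is `Π`-stable in BOTH directions on vertices: `v ∈ ℍ ↔ g · v ∈ ℍ` (`H_stable` for `g` and
`g⁻¹`; `actGraph₀` is a homomorphism to `Aut 𝔾^c`). [cite: Mochizuki2012, Cor 2.3 p.47] -/
theorem mem_H_verts_iff_actGraph₀ (P : PiData X d S T) (g : X.PiTemp) (v : S.Gc.graph.Vertex) :
    v ∈ P.H.verts ↔ (P.actGraph₀ g).hom.vertexMap v ∈ P.H.verts := by
  have h1 : P.actGraph₀ g⁻¹ * P.actGraph₀ g = 1 := by rw [← map_mul, inv_mul_cancel, map_one]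
  refine ⟨(P.H_stable g).1 v, fun hv => ?_⟩
  have h2 := congrArg (fun a : Aut S.Gc.graph => a.hom.vertexMap v) h1
  have h3 : (P.actGraph₀ g⁻¹).hom.vertexMap ((P.actGraph₀ g).hom.vertexMap v) = v := h2
  rw [← h3]
  exact (P.H_stable g⁻¹).1 _ hv

/-- ★ **`hHstab` at the origin record, DERIVED on the cusp-omitted fibre**: for `P : PiData` (finite base fibre),
`g ∈ Π^tp_X`, a sub-semi-graph `ℍ₀ ⊆ 𝒢` of the cusp-omitted base fibre with the SAME VERTICES as the record's `ℍ`
(so vertex-stability is automatic: the derived vertex map IS `actGraph₀ g` on vertices, gen 11's C2, and `ℍ` is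
`actGraph₀`-stable) whose EDGES are stable under the base of the isomorphisms `𝒢 ⥲ 𝒢` compatible with `autOfConj g`
(DISPLAYED: the record constrains `actGraph₀ g` on edges by no law), and every decomposition subgroup `D` of `ℍ₀`
for the transported chart: `∃ t, D.map (autOfConj g) = MulAut.conj t • D` — the conclusion of abc-iut-L5's
`hHstab_of_mem_decompSubgroups_of_graphic` WITHOUT its hypothesis `hgr = P.ActGraphInduces`, at `ℍ₀`.
[cite: Mochizuki2012, IUTchI Cor 2.3(i) p.47] -/
theorem exists_conj_map_autOfConj_of_mem_decompSubgroups (P : PiData X d S T) (g : X.PiTemp)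
    {H₀ : S.graph.graph.Subgraph} (hH₀ : ∀ v : S.graph.graph.Vertex, v ∈ H₀.verts ↔ v.1 ∈ P.H.verts)
    (hHE : ∀ F₀ : Hom S.graph S.graph, F₀.IsIso →
      S.GraphCompatible S (S.autOfConj P.admissibleKer_normal_pi g) F₀ →
        ∀ e, e ∈ H₀.edges ↔ F₀.base.edgeMap e ∈ H₀.edges)
    {Dg : Subgroup S.chart.G}
    (hD : Dg ∈ (S.chart.transport (haveI := S.isEquivalence_btempRestrict_graphOf
        (S.Gc.btempRestrict S.Gc.graph.maximalSubgraph).asEquivalence.symm)).decompSubgroups H₀) :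
    ∃ t : S.chart.G, Dg.map (S.autOfConj P.admissibleKer_normal_pi g).toMulEquiv.toMonoidHom = MulAut.conj t • Dg := by
  haveI := P.finite_vertex; haveI := P.finite_edge
  refine S.exists_conj_map_autOfConj_of_mem_decompSubgroups P.admissibleKer_normal_pi g (fun v => ?_) hHE hD
  calc v ∈ H₀.verts ↔ v.1 ∈ P.H.verts := hH₀ v
    _ ↔ (P.actGraph₀ g).hom.vertexMap v.1 ∈ P.H.verts := P.mem_H_verts_iff_actGraph₀ g v.1
    _ ↔ S.actVertex P.admissibleKer_normal_pi maximalCompactIffVerticialAt_of_finiteGraph g v.1 ∈ P.H.verts := by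
        rw [P.actGraph₀_vertexMap maximalCompactIffVerticialAt_of_finiteGraph g v.1]
    _ ↔ S.maximalSubgraph_isCuspOmission.vtx
          (S.actVertex P.admissibleKer_normal_pi maximalCompactIffVerticialAt_of_finiteGraph g v.1) ∈ H₀.verts :=
        (hH₀ (S.maximalSubgraph_isCuspOmission.vtx
          (S.actVertex P.admissibleKer_normal_pi maximalCompactIffVerticialAt_of_finiteGraph g v.1))).symm

/-- The F₀-form at the record: for a GIVEN isomorphism `F₀ : 𝒢 ⥲ 𝒢` compatible with `autOfConj g` stabilising the
edges of `ℍ₀` (`ℍ₀` with the vertices of `ℍ`), `hHstab` holds for every decomposition subgroup of `ℍ₀`.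
[cite: Mochizuki2012, IUTchI Cor 2.3(i) p.47] -/
theorem exists_conj_map_autOfConj_of_graphCompatible (P : PiData X d S T) (g : X.PiTemp)
    {F₀ : Hom S.graph S.graph} (hF₀ : F₀.IsIso)
    (h : S.GraphCompatible S (S.autOfConj P.admissibleKer_normal_pi g) F₀)
    {H₀ : S.graph.graph.Subgraph} (hH₀ : ∀ v : S.graph.graph.Vertex, v ∈ H₀.verts ↔ v.1 ∈ P.H.verts)
    (hE : ∀ e, e ∈ H₀.edges ↔ F₀.base.edgeMap e ∈ H₀.edges) {Dg : Subgroup S.chart.G}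
    (hD : Dg ∈ (S.chart.transport (haveI := S.isEquivalence_btempRestrict_graphOf
        (S.Gc.btempRestrict S.Gc.graph.maximalSubgraph).asEquivalence.symm)).decompSubgroups H₀) :
    ∃ t : S.chart.G, Dg.map (S.autOfConj P.admissibleKer_normal_pi g).toMulEquiv.toMonoidHom = MulAut.conj t • Dg := by
  haveI := P.finite_vertex; haveI := P.finite_edge
  refine S.exists_conj_map_autOfConj_of_graphCompatible P.admissibleKer_normal_pi g hF₀ h (fun v => ?_) hE hD
  calc v ∈ H₀.verts ↔ v.1 ∈ P.H.verts := hH₀ v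
    _ ↔ (P.actGraph₀ g).hom.vertexMap v.1 ∈ P.H.verts := P.mem_H_verts_iff_actGraph₀ g v.1
    _ ↔ (F₀.base.vertexMap v).1 ∈ P.H.verts := by
        rw [P.vertexMap_eq_actGraph₀_of_graphCompatible g hF₀.isLocallyTrivial.isLocallyOpen h v]
    _ ↔ F₀.base.vertexMap v ∈ H₀.verts := (hH₀ (F₀.base.vertexMap v)).symm

end PiData

end SpecialFibreTower

end Literature.AnabelianGeometry.SemiGraphs

end
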